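import Summits.QuantumFields.BalabanUV.T4Continuum.Support.NE7LandauLinearStraight
import HarnessLib

/-!
# NE7LandauLinearStraightMap — THE LINEAR B5-LANDAU STEP AS A UNIFORM MAP (brick T2′ of ROAD v4): for fixed block side `n₀` and coarse period `N` there is
# ONE map `Φ : Z ↦ σ` (the entrywise assembled `n₀·λ₀(∂* z_{ii′})`, [B5] (1.25)) such that for EVERY direction `Z`: `Z − dΦZ` is exactly in the gauge
# `(1 − P)∂* = 0` entrywise and keeps the straight averages of `Z` (no hypothesis), `ΦZ` is periodic, skew when `Z` is skew, and — for periodic `Z` with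
# flat curls `≤ B`, straight averages `≤ q`, sup `≤ b` — `‖Z − dΦZ‖ ≤ K n₀ B + K′ q`, `‖ΦZ‖ ≤ (d+1)(n₀−1)(card n·b + K n₀ B + K′ q)` (`NE7LandauLinearStraightMap`)

Cell `pub-balaban`, lineage `t4-ne7-p1` (CRUX PROVER NE7 #1 = OWNER of row NE7), gen 74; memo `t4/b2b-balaban-t4-ne7-p1-g74/REP-FLAT-ROAD-v4.md` §3.  WHY.  The
Newton scheme of brick T4 is built by recursion on `ℕ` inside a proof (no `def`): its step must be a TOTAL function of the state, so the gauge function of the linear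
step has to be given by a map defined for all fields, with the estimates attached afterwards under hypotheses — this file re-exports gen 74's T2
(`NE7LandauLinearStraight`: `entry_step`, `lambda0_star`) in exactly that form, the map being explicit (`Matrix.of (i,i′) ↦ n₀·λ₀(∂* z_{ii′})(toT y)`).  §1 adds the
row-sum letter `|Q_k w| ≤ sup|w|` ([B5] (1.18): the weights `q(b;·)` of a coarse bond sum to one), by which the straight datum of a deviation is bounded by its sup.
CONTENT ([folklore]; 0 def, 0 sorry).  §1 `norm_QvOp_mulVec_le`; §2 **`exists_landauMap`**.
HONEST FRAMING (page 1): LINEAR, flat background, abelian entry by entry; constants existential through GAN24's `C(d)`; nothing of Bałaban's asserted; the NONLINEAR top step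
(T4), REP♭ and (APE) are NOT proved here; NE7 NOT PRINTED ∕ NOT PROVED (0∕1); spine PROVED 0∕9; rung (B)+1 finite T⁴ — NOT infinite volume, NOT mass gap, NOT BetaPertH, NOT
Clay.  PLACEMENT: our lemma, under `Summits/QuantumFields/BalabanUV/`.
Continuum YM on T⁴ ⇐ BetaPertH ∧ nine spine estimates (0/9 proved); BetaPertH ⇐ (D1) ∧ (D4) ∧ CAP+tail; G-an2-4 gates asym, D1 and NE2/3/4.
-/

set_option autoImplicit false

open scoped BigOperators Matrix ComplexConjugate Matrix.Norms.L2Operator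
open Finset

namespace Summit.QuantumFields.BalabanUV.T4Continuum.NE7LandauLinearStraightMap

open Literature.MathematicalPhysics.QuantumFieldTheory.Balaban1983to89
open B7Prop1Explicit (Site e e_apply)
open T4AveragingDeficitWall (curlAt IsSkewDir)
open AveragingDeficitPeriodicCounting (IsPeriodicDir)
open B5Prop11Plancherel (Tor fine unitVec)
open B5Action121 (Fs GradOp GradOp_mulVec sdiff_mulVec)
open B5Block118 (QvOp)
open B5Prop11G0Torus (qent qent_rowsum QvOp_eq_qent)
open B5Value126 (PcT lambda0)
open B5DivOrth (sum_GradOp_adjoint)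
open B6LowerBound2153Torus (toT rep toT_rep)
open BlockAveragePushDirSplit (flat)
open NE7TorusBoxDictionary (toT_add_e' apply_rep_toT')
open NE7SliceGreenTestField (toT_add_period)
open NE7FlatHkOrthogonal (entry_eq_neg_conj_of_skew)
open NE7FlatHkCurlLetter (opNorm_le_card_mul)
open NE7LandauLinearSup (residual_landau QvOp_landau)
open NE7LandauExactSup (exists_exact_sup_const)
open NE7LandauLinearStraight (entry_step lambda0_star GradOp_adjoint_mulVec_star)

noncomputable section

variable {d : ℕ} {n : Type*} [Fintype n] [DecidableEq n]

/-! ## §1 The straight average is a contraction in sup -/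

/-- `|(Q_k w)(b)| ≤ sup|w|`: the weights `q(b;i) ≥ 0` of the straight block average sum to one over `i` ([B5] (1.18)). [folklore] -/
theorem norm_QvOp_mulVec_le (m : ℕ) [NeZero m] (M : Fin (d + 1) → ℕ) [∀ μ, NeZero (M μ)] (w : Tor (fine m M) × Fin (d + 1) → ℂ) {ν : ℝ}
    (hw : ∀ i, ‖w i‖ ≤ ν) (b : Tor M × Fin (d + 1)) : ‖(QvOp m M *ᵥ w) b‖ ≤ ν := by
  have hqn : ∀ i, 0 ≤ qent m M b i := fun i => by
    unfold qent
    split_ifs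
    · exact sum_nonneg fun _ _ => sum_nonneg fun _ _ => by positivity
    · exact le_rfl
  simp only [Matrix.mulVec, dotProduct, QvOp_eq_qent]
  calc ‖∑ i, ((qent m M b i : ℝ) : ℂ) * w i‖ ≤ ∑ i, qent m M b i * ν := by
        refine (norm_sum_le _ _).trans (sum_le_sum fun i _ => ?_)
        rw [norm_mul, Complex.norm_real, Real.norm_of_nonneg (hqn i)]
        exact mul_le_mul_of_nonneg_left (hw i) (hqn i)
    _ = ν := by rw [← sum_mul, qent_rowsum, one_mul]

/-! ## §2 The map -/

/-- **THE LINEAR B5-LANDAU STEP AS ONE MAP FOR ALL FIELDS** (dimension `d + 1`): `∃ K, K′ > 0` (functions of `d`, `card n`) such that for every block side `n₀ ≥ 1` and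
`N ≥ 1` there is `Φ : (Site → Fin (d+1) → Matrix) → (Site → Matrix)` with, for EVERY `Z`: `ΦZ` is `(n₀N)`-periodic; `ΦZ` is skew if `Z` is; every entry of
`Z − dΦZ` read on the torus is EXACTLY in the gauge `(1 − P)∂* = 0` and has the straight averages of `Z`; and for `(n₀N)`-periodic `Z` with `‖curl₁ Z‖ ≤ B`,
`|Q_k z_{ii′}| ≤ q`, `‖Z‖ ≤ b`: **`‖Z − dΦZ‖ ≤ K n₀ B + K′ q`**, **`‖ΦZ‖ ≤ (d+1)(n₀−1)(card n·b + K n₀ B + K′ q)`**. [folklore] -/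
theorem exists_landauMap [Nonempty n] :
    ∃ K K' : ℝ, 0 < K ∧ 0 < K' ∧ ∀ (n₀ N : ℕ) [NeZero n₀] [NeZero N],
      ∃ Φ : (Site (d + 1) → Fin (d + 1) → Matrix n n ℂ) → (Site (d + 1) → Matrix n n ℂ), ∀ Z : Site (d + 1) → Fin (d + 1) → Matrix n n ℂ,
        (∀ (y : Site (d + 1)) (ι : Fin (d + 1)), Φ Z (y + ((n₀ * N : ℕ) : ℤ) • e ι) = Φ Z y) ∧
        (IsSkewDir Z → ∀ y : Site (d + 1), Φ Z y ∈ skewAdjoint (Matrix n n ℂ)) ∧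
        (∀ i i' : n, (1 - PcT n₀ (fun _ : Fin (d + 1) => N) (n₀ : ℂ)) *ᵥ ((GradOp (fine n₀ (fun _ : Fin (d + 1) => N)) (n₀ : ℂ))ᴴ *ᵥ
          fun p : Tor (fine n₀ (fun _ : Fin (d + 1) => N)) × Fin (d + 1) =>
            (Z (rep (fine n₀ (fun _ : Fin (d + 1) => N)) p.1) p.2
              - (Φ Z (rep (fine n₀ (fun _ : Fin (d + 1) => N)) p.1 + e p.2) - Φ Z (rep (fine n₀ (fun _ : Fin (d + 1) => N)) p.1))) i i') = 0) ∧
        (∀ (i i' : n) (t : Tor (fun _ : Fin (d + 1) => N)) (κ : Fin (d + 1)),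
          (QvOp n₀ (fun _ : Fin (d + 1) => N) *ᵥ fun p : Tor (fine n₀ (fun _ : Fin (d + 1) => N)) × Fin (d + 1) =>
            (Z (rep (fine n₀ (fun _ : Fin (d + 1) => N)) p.1) p.2
              - (Φ Z (rep (fine n₀ (fun _ : Fin (d + 1) => N)) p.1 + e p.2) - Φ Z (rep (fine n₀ (fun _ : Fin (d + 1) => N)) p.1))) i i') (t, κ)
          = (QvOp n₀ (fun _ : Fin (d + 1) => N) *ᵥ fun p : Tor (fine n₀ (fun _ : Fin (d + 1) => N)) × Fin (d + 1) =>
            Z (rep (fine n₀ (fun _ : Fin (d + 1) => N)) p.1) p.2 i i') (t, κ)) ∧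
        (IsPeriodicDir Z ((n₀ * N : ℕ) : ℤ) →
          ∀ (B : ℝ), (∀ (x : Site (d + 1)) (μ ν : Fin (d + 1)), ‖curlAt (flat (d := d + 1) (n := n)) Z x μ ν‖ ≤ B) →
          ∀ (q : ℝ), (∀ (i i' : n) (t : Tor (fun _ : Fin (d + 1) => N)) (κ : Fin (d + 1)),
            ‖(QvOp n₀ (fun _ : Fin (d + 1) => N) *ᵥ fun p : Tor (fine n₀ (fun _ : Fin (d + 1) => N)) × Fin (d + 1) =>
              Z (rep (fine n₀ (fun _ : Fin (d + 1) => N)) p.1) p.2 i i') (t, κ)‖ ≤ q) →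
          ∀ (b : ℝ), (∀ (y : Site (d + 1)) (κ : Fin (d + 1)), ‖Z y κ‖ ≤ b) →
          (∀ (y : Site (d + 1)) (κ : Fin (d + 1)), ‖Z y κ - (Φ Z (y + e κ) - Φ Z y)‖ ≤ K * (n₀ : ℝ) * B + K' * q) ∧
          (∀ y : Site (d + 1), ‖Φ Z y‖ ≤ ((d + 1 : ℕ) : ℝ) * ((n₀ : ℝ) - 1) * (Fintype.card n * b + K * (n₀ : ℝ) * B + K' * q))) := by
  obtain ⟨C, C', hC, hC', hIS⟩ := exists_exact_sup_const (d := d)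
  refine ⟨Fintype.card n * C, Fintype.card n * C', by positivity, by positivity, fun n₀ N _ _ => ?_⟩
  haveI : NeZero (n₀ * N) := ⟨Nat.mul_ne_zero (NeZero.ne n₀) (NeZero.ne N)⟩
  set T : Fin (d + 1) → ℕ := fine n₀ (fun _ : Fin (d + 1) => N) with hT
  -- THE MAP: `Φ Z y = (n₀·λ₀(∂* z_{ii′})(toT y))_{ii′}`
  refine ⟨fun Z y => Matrix.of fun i i' : n =>
      (n₀ : ℂ) * lambda0 n₀ (fun _ : Fin (d + 1) => N) (n₀ : ℂ) ((GradOp T (n₀ : ℂ))ᴴ *ᵥ fun p : Tor T × Fin (d + 1) => Z (rep T p.1) p.2 i i') (toT T y),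
    fun Z => ?_⟩
  set z : n → n → (Tor T × Fin (d + 1) → ℂ) := fun i i' p => Z (rep T p.1) p.2 i i' with hz
  set s : n → n → (Tor T → ℂ) := fun i i' => lambda0 n₀ (fun _ : Fin (d + 1) => N) (n₀ : ℂ) ((GradOp T (n₀ : ℂ))ᴴ *ᵥ z i i') with hs
  -- the torus restriction of an entry of `Z − dΦZ` is `z − ∂s`
  have hfun : ∀ i i', (fun p : Tor T × Fin (d + 1) => (Z (rep T p.1) p.2
        - ((Matrix.of fun i i' : n => (n₀ : ℂ) * s i i' (toT T (rep T p.1 + e p.2))) - Matrix.of fun i i' : n => (n₀ : ℂ) * s i i' (toT T (rep T p.1)))) i i')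
      = z i i' - GradOp T (n₀ : ℂ) *ᵥ s i i' := by
    intro i i'
    funext p
    simp only [hz, Matrix.sub_apply, Matrix.of_apply, Pi.sub_apply]
    rw [toT_add_e', toT_rep, show GradOp T (n₀ : ℂ) *ᵥ s i i' = fun r => (GradOp T (n₀ : ℂ) *ᵥ s i i') (r.1, r.2) from rfl]
    simp only [GradOp_mulVec, sdiff_mulVec]
    ring
  refine ⟨fun y ι => ?_, fun hZs y => ?_, fun i i' => ?_, fun i i' t κ => ?_, fun hZP B hB q hq b hb => ?_⟩
  · -- periodicity
    ext i i'
    simp only [Matrix.of_apply]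
    rw [show toT T (y + ((n₀ * N : ℕ) : ℤ) • e ι) = toT T y from toT_add_period (d := d + 1) (n₀ * N) y ι]
  · -- skewness
    rw [skewAdjoint.mem_iff]
    ext i i'
    simp only [Matrix.star_apply, Matrix.of_apply, Matrix.neg_apply]
    have hzz : z i' i = -star (z i i') := by
      funext p
      simp only [hz, Pi.neg_apply, Pi.star_apply, RCLike.star_def]
      exact entry_eq_neg_conj_of_skew (hZs (rep T p.1) p.2) i' i
    have hss : s i' i = -star (s i i') := by
      simp only [hs]
      rw [hzz, Matrix.mulVec_neg, GradOp_adjoint_mulVec_star]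
      have hlin : ∀ w : Tor T → ℂ, lambda0 n₀ (fun _ : Fin (d + 1) => N) (n₀ : ℂ) (-w) = -lambda0 n₀ (fun _ : Fin (d + 1) => N) (n₀ : ℂ) w := by
        intro w
        simp only [B5Value126.lambda0_eq_LapSinv, Matrix.mulVec_neg]
      rw [hlin, lambda0_star n₀ (fun _ : Fin (d + 1) => N) _ (sum_GradOp_adjoint T (n₀ : ℂ) (z i i'))]
    change star ((n₀ : ℂ) * s i' i (toT T y)) = -((n₀ : ℂ) * s i i' (toT T y))
    simp only [hss, Pi.neg_apply, Pi.star_apply, RCLike.star_def, map_mul, map_neg, Complex.conj_conj, Complex.conj_natCast, mul_neg]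
  · -- exact gauge
    rw [hfun]
    exact residual_landau n₀ (fun _ : Fin (d + 1) => N) (z i i')
  · -- straight datum unchanged
    rw [hfun]
    exact congrFun (QvOp_landau n₀ (fun _ : Fin (d + 1) => N) (z i i')) (t, κ)
  · -- the estimates
    have key := fun i i' => entry_step (n := n) hC hC' hIS n₀ N hZP hB hb i i' (hq i i')
    refine ⟨fun y κ => ?_, fun y => ?_⟩
    · have hent : ∀ i i', ‖(Z y κ - ((Matrix.of fun i i' : n => (n₀ : ℂ) * s i i' (toT T (y + e κ))) - Matrix.of fun i i' : n => (n₀ : ℂ) * s i i' (toT T y))) i i'‖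
          ≤ C * ((n₀ : ℝ) * B) + C' * q := by
        intro i i'
        have h := (key i i').2.2.1 (toT T y, κ)
        simp only [Pi.sub_apply, GradOp_mulVec, sdiff_mulVec] at h
        rw [apply_rep_toT' (P := n₀ * N) hZP y κ] at h
        simp only [Matrix.sub_apply, Matrix.of_apply]
        rw [toT_add_e', ← mul_sub]
        exact h
      calc _ ≤ Fintype.card n * (C * ((n₀ : ℝ) * B) + C' * q) := opNorm_le_card_mul _ hent
        _ = Fintype.card n * C * (n₀ : ℝ) * B + Fintype.card n * C' * q := by ring
    · have hent : ∀ i i', ‖(Matrix.of fun i i' : n => (n₀ : ℂ) * s i i' (toT T y)) i i'‖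
          ≤ ((d + 1 : ℕ) : ℝ) * ((n₀ : ℝ) - 1) * (b + (C * ((n₀ : ℝ) * B) + C' * q)) := by
        intro i i'
        simpa only [Matrix.of_apply] using (key i i').2.2.2 (toT T y)
      exact (opNorm_le_card_mul _ hent).trans (le_of_eq (by ring))

end

end Summit.QuantumFields.BalabanUV.T4Continuum.NE7LandauLinearStraightMap
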